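import Summits.CriticalPhenomena.PercolationContinuityZ3.Theorems.PercNearOneGluingAdditiveGluingGenPair
import Literature.Probability.Percolation.KozmaNitzanSeparatingTriple
import HarnessLib

/-!
# Kozma–Nitzan's Question 8 / MC-D for three relays — the attachment row on `{x↮z}` ("ODvsPD") for EVERY pocket family

Support file (`--supports stmt-CriticalPhenomena-4575`, closed), prover `prim-lf-2` (gen 21).  No definitions, no named facts, no sorries;
standard axioms.  Memos `prim-lf-2/PXI-gen19.md` §4.2 (the BHK row `ODvsPD` used in the X₂-elimination `PCOV^ξ ⟸ T_X`) and
`prim-lf-2/DC-gen21.md` §0(5) (its Question-9 instance `LIFT_v`: `P_H(U | v ∈ C_x, x↮z) ≥ P_{H−v}(U | x↮z)`).  Companion of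
`…KnQuestion8PocketAttach.lean` (`PocketCert.attach_of_pocket`, the same row on `E1 = {x↮y} ∩ {x↮z}`); here the avoided set is `{z}` alone,
so the row lives on `D = {x↮z} ⊇ E1` and needs only that the pocket family avoids `z`:
* `PocketCert.attach_of_pocketD` — owner `x`, observer `o`, avoided `z`, `𝒟` a down-closed family of vertex sets none of which contains `z`,
  `P = {C_o ∈ 𝒟}`, `F` monotone on vertex sets:
  `μ({x↔o} ∩ {x↮z}) · ∫_{P ∩ {x↮z}} F(C x) ≤ μ(P ∩ {x↮z}) · ∫_{{x↔o} ∩ {x↮z}} F(C x)`, i.e. `E[F(C x) | o ∈ C x, x↮z] ≥ E[F(C x) | C_o ∈ 𝒟, x↮z]`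
  (law(C_x | OD) ≽ law(C_x | PD) on increasing functionals).
  Proof: both events lie in `{S ↮ T}` for `S = {x,o}`, `T = {z}`; as functions of the edge cluster `C_S` (`KNSep.reachable_iff_cluster`) `F(C x)` and
  `1{o ∈ C x}` are increasing and `1{C_o ∈ 𝒟}` is decreasing, so van den Berg–Häggström–Kahn's Theorem 2.1 (`BHK2006_setClusterConditionalPositiveAssociation`)
  gives `E[F | o∈C x, S↮T] ≥ E[F | S↮T] ≥ E[F | C_o∈𝒟, S↮T]`, combined denominator-free.  For `𝒟 = {W | W ⊆ {o}}` (Question 9's pocket `{C_o = {o}}`)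
  the right side is the law of `C_x` in `G − o` given `x↮z`.
Census (prim-lf-2 gen 21, exact): the Question-8 and Question-9 instances 0 violations in 1 391 + 43 374 checks (DC-gen21.md §0).
[cite: VandenbergHaggstromKahn2005, Thm. 2.1 (p. 9), Remark 1 after Thm. 1.2 (p. 5)] [cite: KozmaNitzan2024, Questions 8–9 (§5.5 p. 36)]
-/

namespace Summit.CriticalPhenomena.PercolationContinuityZ3.Theorems

open MeasureTheory Set Literature.Probability.LatticeModels Literature.Probability.Percolation
open scoped Classical
open KNPreFKG

noncomputable section

namespace PocketCert

variable {V : Type*} [Fintype V]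

/-- **The attachment row on `{x↮z}` ("ODvsPD") for every pocket family.**  `𝒟` a down-closed family of vertex sets avoiding `z`,
`P = {C_o ∈ 𝒟}`, `D = {x↮z}`, `F` monotone: `μ({x↔o} ∩ D) · ∫_{P ∩ D} F(C x) ≤ μ(P ∩ D) · ∫_{{x↔o} ∩ D} F(C x)`.
[cite: VandenbergHaggstromKahn2005, Thm. 2.1 (p. 9)] [cite: KozmaNitzan2024, Questions 8–9 (§5.5 p. 36)] -/
theorem attach_of_pocketD (w : Sym2 V → unitInterval) (o x z : V) (𝒟 : Set (Set V)) (h𝒟 : IsLowerSet 𝒟)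
    (hz : ∀ W ∈ 𝒟, z ∉ W) (F : Set V → ℝ) (hF : ∀ S T : Set V, S ⊆ T → F S ≤ F T) :
    (prodBernoulli w).real (openConn x o ∩ {ω | ¬ (openGraph ω).Reachable x z}) *
        ∫ ω in {ω : BondConfig V | openCluster ω o ∈ 𝒟} ∩ {ω | ¬ (openGraph ω).Reachable x z},
          F (openCluster ω x) ∂(prodBernoulli w) ≤
      (prodBernoulli w).real ({ω : BondConfig V | openCluster ω o ∈ 𝒟} ∩ {ω | ¬ (openGraph ω).Reachable x z}) *
        ∫ ω in openConn x o ∩ {ω | ¬ (openGraph ω).Reachable x z},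
          F (openCluster ω x) ∂(prodBernoulli w) := by
  classical
  set μ := prodBernoulli w with hμ
  set f : BondConfig V → ℝ := fun ω => F (openCluster ω x) with hf
  have hmeas : ∀ S' : Set (BondConfig V), MeasurableSet S' := fun _ => MeasurableSet.of_discrete
  have hn := fun (S' : Set (BondConfig V)) => (measureReal_nonneg : 0 ≤ μ.real S')
  set S : Set V := {x, o} with hS
  set T : Set V := {z} with hT
  set D : Set (BondConfig V) := {ω : BondConfig V | ∀ s ∈ S, ∀ t ∈ T, ¬ (openGraph ω).Reachable s t} with hD
  set O : Set (BondConfig V) := openConn x o ∩ {ω | ¬ (openGraph ω).Reachable x z} with hO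
  set P : Set (BondConfig V) := {ω : BondConfig V | openCluster ω o ∈ 𝒟} ∩ {ω | ¬ (openGraph ω).Reachable x z} with hP
  -- three monotone functions of the edge cluster of `S`
  set Fe : Set (Sym2 V) → ℝ := fun C => F (openCluster C x) with hFe
  set Ge : Set (Sym2 V) → ℝ := fun C => (openCluster C x).indicator (1 : V → ℝ) o with hGe
  set He : Set (Sym2 V) → ℝ := fun C => if openCluster C o ∈ 𝒟 then 0 else 1 with hHe
  have hFe_mono : Monotone Fe := fun C C' hCC' => hF _ _ (openCluster_mono hCC' x)
  have hGe_mono : Monotone Ge := by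
    intro C C' hCC'
    simp only [hGe]
    by_cases h : o ∈ openCluster C x
    · rw [indicator_of_mem h, indicator_of_mem (openCluster_mono hCC' x h)]
    · rw [indicator_of_notMem h]
      by_cases h' : o ∈ openCluster C' x
      · rw [indicator_of_mem h']; simp
      · rw [indicator_of_notMem h']
  have hHe_mono : Monotone He := by
    intro C C' hCC'
    simp only [hHe]
    by_cases h' : openCluster C' o ∈ 𝒟
    · rw [if_pos h', if_pos (h𝒟 (openCluster_mono hCC' o) h')]
    · rw [if_neg h']; split_ifs <;> norm_num
  have hxS : x ∈ S := by simp [hS]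
  have hoS : o ∈ S := by simp [hS]
  have hclx : ∀ ω : BondConfig V, openCluster (⋃ s ∈ S, openEdgeCluster ω s) x = openCluster ω x := by
    intro ω; ext a; exact (KNSep.reachable_iff_cluster ω S hxS a).symm
  have hclo : ∀ ω : BondConfig V, openCluster (⋃ s ∈ S, openEdgeCluster ω s) o = openCluster ω o := by
    intro ω; ext a; exact (KNSep.reachable_iff_cluster ω S hoS a).symm
  have hFe_eq : ∀ ω : BondConfig V, Fe (⋃ s ∈ S, openEdgeCluster ω s) = f ω := by
    intro ω; simp only [hFe, hf, hclx ω]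
  have hGe_eq : ∀ ω : BondConfig V, Ge (⋃ s ∈ S, openEdgeCluster ω s) = (openConn x o : Set (BondConfig V)).indicator 1 ω := by
    intro ω; simp only [hGe, hclx ω]
    by_cases h : (openGraph ω).Reachable x o
    · rw [indicator_of_mem (show o ∈ openCluster ω x from h), indicator_of_mem (show ω ∈ openConn x o from h)]
      simp
    · rw [indicator_of_notMem (show o ∉ openCluster ω x from h), indicator_of_notMem (show ω ∉ openConn x o from h)]
  have hHe_eq : ∀ ω : BondConfig V, He (⋃ s ∈ S, openEdgeCluster ω s) =
      ({ω' : BondConfig V | openCluster ω' o ∈ 𝒟}ᶜ : Set (BondConfig V)).indicator 1 ω := by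
    intro ω; simp only [hHe, hclo ω]
    by_cases h : openCluster ω o ∈ 𝒟
    · rw [if_pos h, indicator_of_notMem (show ω ∉ ({ω' : BondConfig V | openCluster ω' o ∈ 𝒟}ᶜ : Set (BondConfig V)) from
        fun hc => hc h)]
    · rw [if_neg h, indicator_of_mem (show ω ∈ ({ω' : BondConfig V | openCluster ω' o ∈ 𝒟}ᶜ : Set (BondConfig V)) from h),
        Pi.one_apply]
  -- the events inside `D`
  have hDO : D ∩ openConn x o = O := by
    ext ω
    simp only [hD, hO, hS, hT, mem_setOf_eq, mem_inter_iff, mem_insert_iff, mem_singleton_iff, openConn, forall_eq_or_imp,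
      forall_eq]
    constructor
    · rintro ⟨⟨hxz, -⟩, hxo⟩
      exact ⟨hxo, hxz⟩
    · rintro ⟨hxo, hxz⟩
      exact ⟨⟨hxz, fun hoz => hxz (hxo.trans hoz)⟩, hxo⟩
  have hDE1 : ∀ ω ∈ D, ω ∈ ({ω | ¬ (openGraph ω).Reachable x z} : Set (BondConfig V)) :=
    fun ω hd => hd x hxS z (by simp [hT])
  have hDP : D ∩ {ω : BondConfig V | openCluster ω o ∈ 𝒟}ᶜ = D \ P := by
    ext ω
    constructor
    · rintro ⟨hd, hnot⟩
      exact ⟨hd, fun hP' => hnot hP'.1⟩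
    · rintro ⟨hd, hnP⟩
      exact ⟨hd, fun hm => hnP ⟨hm, hDE1 ω hd⟩⟩
  have hPD : P ⊆ D := by
    intro ω hω
    simp only [hD, hS, hT, mem_setOf_eq, mem_insert_iff, mem_singleton_iff, forall_eq_or_imp, forall_eq]
    have hm : openCluster ω o ∈ 𝒟 := hω.1
    exact ⟨hω.2, fun h => hz _ hm h⟩
  -- (i) positive association of `F(C x)` and `1{o ∈ C x}` given `D`
  have h1 := BHK2006_setClusterConditionalPositiveAssociation w S T Fe Ge hFe_mono hGe_mono
  simp_rw [hFe_eq, hGe_eq] at h1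
  rw [setIntegral_indicator_one_eq μ D (openConn x o), setIntegral_mul_indicator_one μ D (openConn x o) f, hDO] at h1
  -- h1 : (∫_D f) * μ O ≤ μ D * ∫_O f
  -- (ii) positive association of `F(C x)` and `1{C_o ∉ 𝒟}` given `D`
  have h2 := BHK2006_setClusterConditionalPositiveAssociation w S T Fe He hFe_mono hHe_mono
  simp_rw [hFe_eq, hHe_eq] at h2
  rw [setIntegral_indicator_one_eq μ D ({ω' : BondConfig V | openCluster ω' o ∈ 𝒟}ᶜ),
    setIntegral_mul_indicator_one μ D ({ω' : BondConfig V | openCluster ω' o ∈ 𝒟}ᶜ) f, hDP] at h2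
  -- h2 : (∫_D f) * μ (D \ P) ≤ μ D * ∫_{D \ P} f
  have hdisj : Disjoint P (D \ P) := Set.disjoint_sdiff_right
  have eP : μ.real (D \ P) = μ.real D - μ.real P := by
    have h := measureReal_union (μ := μ) hdisj (hmeas (D \ P))
    rw [Set.union_sdiff_cancel hPD] at h
    linarith
  have iP : ∫ ω in D \ P, f ω ∂μ = (∫ ω in D, f ω ∂μ) - ∫ ω in P, f ω ∂μ := by
    have h := setIntegral_union (μ := μ) (f := f) hdisj (hmeas (D \ P)) (Integrable.of_finite).integrableOn
      (Integrable.of_finite).integrableOn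
    rw [Set.union_sdiff_cancel hPD] at h
    linarith
  rw [eP, iP] at h2
  -- h2 : (∫_D f)(μD − μP) ≤ μD (∫_D f − ∫_P f)  ⟹  μD ∫_P f ≤ μP ∫_D f
  -- combine: μP·(h1) + μO·(h2)
  have key : μ.real D * (μ.real P * ∫ ω in O, f ω ∂μ - μ.real O * ∫ ω in P, f ω ∂μ) ≥ 0 := by
    nlinarith [mul_le_mul_of_nonneg_left h1 (hn P), mul_le_mul_of_nonneg_left h2 (hn O), hn D]
  by_cases hD0 : μ.real D = 0
  · -- then `O` and `P` are null inside `D`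
    have hO0 : μ.real O = 0 := le_antisymm (by rw [← hD0, ← hDO]; exact measureReal_mono inter_subset_left) (hn O)
    have hP0 : μ.real P = 0 := le_antisymm (by rw [← hD0]; exact measureReal_mono hPD) (hn P)
    rw [hO0, hP0]
    simp
  · have hDpos : 0 < μ.real D := lt_of_le_of_ne (hn D) (Ne.symm hD0)
    have hX : (0 : ℝ) ≤ μ.real P * ∫ ω in O, f ω ∂μ - μ.real O * ∫ ω in P, f ω ∂μ :=
      le_of_mul_le_mul_left (by rw [mul_zero]; exact key.le) hDpos
    linarith

/-- **The pocket law lies below the separated law on `{x↮z}`** (the second half of `attach_of_pocketD` on its own).  `𝒟` down-closed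
avoiding `z`, `P = {C_o ∈ 𝒟}`, `Δ = {x↮z} ∩ {o↮z}`, `F` monotone:  `μ(Δ) · ∫_{P ∩ {x↮z}} F(C x) ≤ μ(P ∩ {x↮z}) · ∫_Δ F(C x)`, i.e.
`E[F(C x) | C_o ∈ 𝒟, x↮z] ≤ E[F(C x) | x↮z, o↮z]` (positive association of the edge cluster of `S = {x,o}` given `S ↮ {z}`:
`F(C x)` is increasing and `1{C_o ∈ 𝒟}` decreasing).  Used by prim-hp-7 gen 37 at the special edge `x–o` of the one-edge Bernstein route.
[cite: VandenbergHaggstromKahn2005, Thm. 2.1 (p. 9)] -/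
theorem pocketD_le_sep (w : Sym2 V → unitInterval) (o x z : V) (𝒟 : Set (Set V)) (h𝒟 : IsLowerSet 𝒟)
    (hz : ∀ W ∈ 𝒟, z ∉ W) (F : Set V → ℝ) (hF : ∀ S T : Set V, S ⊆ T → F S ≤ F T) :
    (prodBernoulli w).real ({ω : BondConfig V | ¬ (openGraph ω).Reachable x z} ∩ {ω | ¬ (openGraph ω).Reachable o z}) *
        ∫ ω in {ω : BondConfig V | openCluster ω o ∈ 𝒟} ∩ {ω | ¬ (openGraph ω).Reachable x z},
          F (openCluster ω x) ∂(prodBernoulli w) ≤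
      (prodBernoulli w).real ({ω : BondConfig V | openCluster ω o ∈ 𝒟} ∩ {ω | ¬ (openGraph ω).Reachable x z}) *
        ∫ ω in {ω : BondConfig V | ¬ (openGraph ω).Reachable x z} ∩ {ω | ¬ (openGraph ω).Reachable o z},
          F (openCluster ω x) ∂(prodBernoulli w) := by
  classical
  set μ := prodBernoulli w with hμ
  set f : BondConfig V → ℝ := fun ω => F (openCluster ω x) with hf
  have hmeas : ∀ S' : Set (BondConfig V), MeasurableSet S' := fun _ => MeasurableSet.of_discrete
  have hn := fun (S' : Set (BondConfig V)) => (measureReal_nonneg : 0 ≤ μ.real S')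
  set S : Set V := {x, o} with hS
  set T : Set V := {z} with hT
  set D : Set (BondConfig V) := {ω : BondConfig V | ∀ s ∈ S, ∀ t ∈ T, ¬ (openGraph ω).Reachable s t} with hD
  set P : Set (BondConfig V) := {ω : BondConfig V | openCluster ω o ∈ 𝒟} ∩ {ω | ¬ (openGraph ω).Reachable x z} with hP
  have hDelta : ({ω : BondConfig V | ¬ (openGraph ω).Reachable x z} ∩ {ω | ¬ (openGraph ω).Reachable o z}) = D := by
    ext ω
    simp only [hD, hS, hT, mem_setOf_eq, mem_inter_iff, mem_insert_iff, mem_singleton_iff, forall_eq_or_imp, forall_eq]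
  rw [hDelta]
  set Fe : Set (Sym2 V) → ℝ := fun C => F (openCluster C x) with hFe
  set He : Set (Sym2 V) → ℝ := fun C => if openCluster C o ∈ 𝒟 then 0 else 1 with hHe
  have hFe_mono : Monotone Fe := fun C C' hCC' => hF _ _ (openCluster_mono hCC' x)
  have hHe_mono : Monotone He := by
    intro C C' hCC'
    simp only [hHe]
    by_cases h' : openCluster C' o ∈ 𝒟
    · rw [if_pos h', if_pos (h𝒟 (openCluster_mono hCC' o) h')]
    · rw [if_neg h']; split_ifs <;> norm_num
  have hxS : x ∈ S := by simp [hS]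
  have hoS : o ∈ S := by simp [hS]
  have hclx : ∀ ω : BondConfig V, openCluster (⋃ s ∈ S, openEdgeCluster ω s) x = openCluster ω x := by
    intro ω; ext a; exact (KNSep.reachable_iff_cluster ω S hxS a).symm
  have hclo : ∀ ω : BondConfig V, openCluster (⋃ s ∈ S, openEdgeCluster ω s) o = openCluster ω o := by
    intro ω; ext a; exact (KNSep.reachable_iff_cluster ω S hoS a).symm
  have hFe_eq : ∀ ω : BondConfig V, Fe (⋃ s ∈ S, openEdgeCluster ω s) = f ω := by
    intro ω; simp only [hFe, hf, hclx ω]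
  have hHe_eq : ∀ ω : BondConfig V, He (⋃ s ∈ S, openEdgeCluster ω s) =
      ({ω' : BondConfig V | openCluster ω' o ∈ 𝒟}ᶜ : Set (BondConfig V)).indicator 1 ω := by
    intro ω; simp only [hHe, hclo ω]
    by_cases h : openCluster ω o ∈ 𝒟
    · rw [if_pos h, indicator_of_notMem (show ω ∉ ({ω' : BondConfig V | openCluster ω' o ∈ 𝒟}ᶜ : Set (BondConfig V)) from
        fun hc => hc h)]
    · rw [if_neg h, indicator_of_mem (show ω ∈ ({ω' : BondConfig V | openCluster ω' o ∈ 𝒟}ᶜ : Set (BondConfig V)) from h),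
        Pi.one_apply]
  have hDE1 : ∀ ω ∈ D, ω ∈ ({ω | ¬ (openGraph ω).Reachable x z} : Set (BondConfig V)) :=
    fun ω hd => hd x hxS z (by simp [hT])
  have hDP : D ∩ {ω : BondConfig V | openCluster ω o ∈ 𝒟}ᶜ = D \ P := by
    ext ω
    constructor
    · rintro ⟨hd, hnot⟩
      exact ⟨hd, fun hP' => hnot hP'.1⟩
    · rintro ⟨hd, hnP⟩
      exact ⟨hd, fun hm => hnP ⟨hm, hDE1 ω hd⟩⟩
  have hPD : P ⊆ D := by
    intro ω hω
    simp only [hD, hS, hT, mem_setOf_eq, mem_insert_iff, mem_singleton_iff, forall_eq_or_imp, forall_eq]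
    have hm : openCluster ω o ∈ 𝒟 := hω.1
    exact ⟨hω.2, fun h => hz _ hm h⟩
  have h2 := BHK2006_setClusterConditionalPositiveAssociation w S T Fe He hFe_mono hHe_mono
  simp_rw [hFe_eq, hHe_eq] at h2
  rw [setIntegral_indicator_one_eq μ D ({ω' : BondConfig V | openCluster ω' o ∈ 𝒟}ᶜ),
    setIntegral_mul_indicator_one μ D ({ω' : BondConfig V | openCluster ω' o ∈ 𝒟}ᶜ) f, hDP] at h2
  have hdisj : Disjoint P (D \ P) := Set.disjoint_sdiff_right
  have eP : μ.real (D \ P) = μ.real D - μ.real P := by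
    have h := measureReal_union (μ := μ) hdisj (hmeas (D \ P))
    rw [Set.union_sdiff_cancel hPD] at h
    linarith
  have iP : ∫ ω in D \ P, f ω ∂μ = (∫ ω in D, f ω ∂μ) - ∫ ω in P, f ω ∂μ := by
    have h := setIntegral_union (μ := μ) (f := f) hdisj (hmeas (D \ P)) (Integrable.of_finite).integrableOn
      (Integrable.of_finite).integrableOn
    rw [Set.union_sdiff_cancel hPD] at h
    linarith
  rw [eP, iP] at h2
  -- h2 : (∫_D f)(μD − μP) ≤ μD (∫_D f − ∫_P f)
  nlinarith [h2]

/-- **(S-xo) of prim-hp-7 gen 37: the union cluster under separation dominates the pocket law.**  `𝒟` down-closed avoiding `z`,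
`P = {C_o ∈ 𝒟}`, `Δ = {x↮z} ∩ {o↮z}`, `F` monotone:  `μ(Δ) · ∫_{P ∩ {x↮z}} F(C x) ≤ μ(P ∩ {x↮z}) · ∫_Δ F(C x ∪ C o)`, i.e.
`law(C_x ∪ C_o | z ∉ C_x ∪ C_o) ≽ law(C_x | x↮z, C_o ∈ 𝒟)` on increasing functionals — `pocketD_le_sep` followed by `C x ⊆ C x ∪ C o`.
For the Question-8 pocket this is the Bernstein coefficient `3B₁/c⁰ ≥ 0` at the special edge `x–o` (prim-hp-7 FROM-…-g37-PCOV-BERNSTEIN §5, 0 / 3 327).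
[cite: VandenbergHaggstromKahn2005, Thm. 2.1 (p. 9)] [cite: KozmaNitzan2024, Questions 8–9 (§5.5 p. 36)] -/
theorem union_sep_of_pocketD (w : Sym2 V → unitInterval) (o x z : V) (𝒟 : Set (Set V)) (h𝒟 : IsLowerSet 𝒟)
    (hz : ∀ W ∈ 𝒟, z ∉ W) (F : Set V → ℝ) (hF : ∀ S T : Set V, S ⊆ T → F S ≤ F T) :
    (prodBernoulli w).real ({ω : BondConfig V | ¬ (openGraph ω).Reachable x z} ∩ {ω | ¬ (openGraph ω).Reachable o z}) *
        ∫ ω in {ω : BondConfig V | openCluster ω o ∈ 𝒟} ∩ {ω | ¬ (openGraph ω).Reachable x z},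
          F (openCluster ω x) ∂(prodBernoulli w) ≤
      (prodBernoulli w).real ({ω : BondConfig V | openCluster ω o ∈ 𝒟} ∩ {ω | ¬ (openGraph ω).Reachable x z}) *
        ∫ ω in {ω : BondConfig V | ¬ (openGraph ω).Reachable x z} ∩ {ω | ¬ (openGraph ω).Reachable o z},
          F (openCluster ω x ∪ openCluster ω o) ∂(prodBernoulli w) := by
  classical
  have h1 := pocketD_le_sep w o x z 𝒟 h𝒟 hz F hF
  have hmono : ∫ ω in {ω : BondConfig V | ¬ (openGraph ω).Reachable x z} ∩ {ω | ¬ (openGraph ω).Reachable o z},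
        F (openCluster ω x) ∂(prodBernoulli w) ≤
      ∫ ω in {ω : BondConfig V | ¬ (openGraph ω).Reachable x z} ∩ {ω | ¬ (openGraph ω).Reachable o z},
        F (openCluster ω x ∪ openCluster ω o) ∂(prodBernoulli w) := by
    apply setIntegral_mono_on (Integrable.of_finite).integrableOn (Integrable.of_finite).integrableOn MeasurableSet.of_discrete
    intro ω _
    exact hF _ _ subset_union_left
  have hn : 0 ≤ (prodBernoulli w).real ({ω : BondConfig V | openCluster ω o ∈ 𝒟} ∩ {ω | ¬ (openGraph ω).Reachable x z}) :=
    measureReal_nonneg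
  nlinarith [mul_le_mul_of_nonneg_left hmono hn]

end PocketCert

end

end Summit.CriticalPhenomena.PercolationContinuityZ3.Theorems
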